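import Literature.IUT.HodgeTheaters.DiscreteProfiniteConjugates
import Mathlib.GroupTheory.FreeGroup.NielsenSchreier
import Mathlib.GroupTheory.SpecificGroups.Cyclic
import Mathlib.Algebra.FreeAbelianGroup.Finsupp
import Mathlib.Tactic.LinearCombination
import Mathlib.Tactic.LinearCombinationPrime
import HarnessLib

/-!
# [IUTchI] Lemma 2.7 (iii), free case, I: the rank-two character of a non-commuting pair

Mochizuki, *Inter-universal Teichmüller theory I*, kurims manuscript (May 2020), §2, Lemma 2.7
"Well-known Properties of Free Groups and Orientable Surface Groups", (iii), p. 57, proof p. 58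
[cite: Mochizuki2012, Lem 2.7(iii) pp.57-58].  PROOF-ONLY companion of the statement file
`DiscreteProfiniteConjugates.lean` (abc-iut-L5-t1) next to `DiscreteProfiniteConjugatesProofs.lean`
(free halves of (i), (ii), (iv), abc-iut-L5-t9); no new definitions.  The sequel
`DiscreteProfiniteConjugatesAbelianRank.lean` proves Lemma 2.7 (iii) for free groups from the
results of this file.

* `isCyclic_freeGroup_of_subsingleton`, `isCyclic_of_subsingleton_generators`,
  `exists_ne_generators_of_ne` — a free group on `≤ 1` letter is cyclic, so two NON-commuting
  elements of a free group force two distinct letters `b₀ ≠ b₁` in any basis of the free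
  (Nielsen–Schreier) subgroup they generate;
* `exists_hom_closure_pair` — **"`J` [= ⟨x, y⟩, `x, y` non-commuting] is a free group of rank 2"**
  (p. 58) in the usable form: there is a homomorphism `Ψ : ⟨x, y⟩ → ℤ × ℤ` with `Ψ x = (1, 0)`,
  `Ψ y = (0, 1)`.  Proof: the coordinate characters of `b₀, b₁` evaluated at `x, y` give an
  integer `2 × 2` matrix which — `b₀, b₁` being words in the generators `x, y` of `J` — has an
  integer left inverse, hence (product of determinants `= 1`) an integer two-sided inverse;
* `abelianization_pair_independent` (the images of `x, y` in `⟨x, y⟩ᵃᵇ` satisfy no non-trivial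
  relation), `zpow_mul_zpow_ne_one` (p. 58: "hence `xᵃ · yᵇ ≠ 1` for all `(a, b) ≠ (0, 0)`"),
  `commute_of_zpow_mul_zpow_eq_one` (Lyndon–Schupp, *Combinatorial Group Theory*, I.2.17: in a
  free group, elements with a non-trivial relation between their powers commute);
* `abelianization_eq_one_of_pow_eq_one` — "the abelianization of any finite index subgroup of `G`
  is torsion-free" (p. 58), free case: `Kᵃᵇ ≅ ℤ^{(B)}` is torsion-free for every free group `K`.

Nothing here takes a side on the disputed parts of [IUTchI–IV]: Lemma 2.7 is classical
combinatorial group theory.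
-/

namespace Literature.IUT.HodgeTheaters

namespace FreeOrSurface

universe u

/-! ### Free groups on at most one generator are cyclic; abelian free groups -/

/-- A free group on a type with at most one element is cyclic (trivial, resp. infinite cyclic).
[cite: Mochizuki2012, Lem 2.7(iv) p.58] -/
theorem isCyclic_freeGroup_of_subsingleton (B : Type*) [Subsingleton B] :
    IsCyclic (FreeGroup B) := by
  rcases isEmpty_or_nonempty B with hB | ⟨⟨b⟩⟩
  · refine isCyclic_iff_exists_zpowers_eq_top.mpr ⟨1, ?_⟩
    rw [eq_top_iff]
    rintro w -
    have hw : w = 1 := by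
      induction w using FreeGroup.induction_on with
      | C1 => rfl
      | of x => exact isEmptyElim x
      | inv_of x _ => exact isEmptyElim x
      | mul x y hx hy => rw [hx, hy, one_mul]
    rw [hw]
    exact Subgroup.one_mem _
  · refine isCyclic_iff_exists_zpowers_eq_top.mpr ⟨FreeGroup.of b, ?_⟩
    rw [eq_top_iff]
    rintro w -
    induction w using FreeGroup.induction_on with
    | C1 => exact Subgroup.one_mem _
    | of x => rw [Subsingleton.elim x b]; exact Subgroup.mem_zpowers _
    | inv_of x _ => rw [Subsingleton.elim x b]; exact Subgroup.inv_mem _ (Subgroup.mem_zpowers _)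
    | mul x y hx hy => exact Subgroup.mul_mem _ hx hy

/-- A free group whose (chosen) basis has at most one element is cyclic.
[cite: Mochizuki2012, Lem 2.7(iv) p.58] -/
theorem isCyclic_of_subsingleton_generators (K : Type*) [Group K] [IsFreeGroup K]
    [Subsingleton (IsFreeGroup.Generators K)] : IsCyclic K :=
  haveI := isCyclic_freeGroup_of_subsingleton (IsFreeGroup.Generators K)
  isCyclic_of_surjective (IsFreeGroup.toFreeGroup K).symm (IsFreeGroup.toFreeGroup K).symm.surjective

/-- In a cyclic group any two elements commute. [cite: Mochizuki2012, Lem 2.7(iv) p.58] -/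
theorem mul_comm_of_isCyclic {K : Type*} [Group K] [IsCyclic K] (a b : K) : a * b = b * a := by
  obtain ⟨g, hg⟩ := IsCyclic.exists_generator (α := K)
  obtain ⟨m, rfl⟩ := Subgroup.mem_zpowers_iff.mp (hg a)
  obtain ⟨n, rfl⟩ := Subgroup.mem_zpowers_iff.mp (hg b)
  rw [← zpow_add, ← zpow_add, add_comm]

/-- If two elements of a free group do not commute, the (chosen) basis has two distinct elements.
[cite: Mochizuki2012, Lem 2.7(iii) p.58] -/
theorem exists_ne_generators_of_ne {K : Type*} [Group K] [IsFreeGroup K] {a b : K}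
    (h : a * b ≠ b * a) : ∃ b₀ b₁ : IsFreeGroup.Generators K, b₀ ≠ b₁ := by
  by_contra hne
  push Not at hne
  haveI : Subsingleton (IsFreeGroup.Generators K) := ⟨hne⟩
  haveI := isCyclic_of_subsingleton_generators K
  exact h (mul_comm_of_isCyclic a b)

/-! ### The rank-two character of a non-commuting pair (step of Lemma 2.7 (iii), p. 58) -/

/-- **`J = ⟨x, y⟩` is free of rank two** (p. 58, proof of (iii)), in the following usable form: for
non-commuting elements `x, y` of a free group there is a homomorphism `Ψ : ⟨x, y⟩ → ℤ × ℤ` with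
`Ψ(x) = (1, 0)` and `Ψ(y) = (0, 1)`.  Proof: `J` is free (Nielsen–Schreier) on a basis `B` with two
distinct elements `b₀ ≠ b₁` (else `J` is cyclic); the coordinate characters `Φ₀, Φ₁ : J → ℤ` of
`b₀, b₁` take values `(p₀, p₁)` at `x` and `(q₀, q₁)` at `y`; writing `b₀, b₁` as words in the
generators `x, y` of `J` shows that the integer matrix `(p₀ p₁ / q₀ q₁)` has an integer left inverse,
hence (a `2 × 2` integer matrix) an integer two-sided inverse `(α₀ β₀ / α₁ β₁)`, and
`Ψ = (α₀Φ₀ + α₁Φ₁, β₀Φ₀ + β₁Φ₁)` works. [cite: Mochizuki2012, Lem 2.7(iii) p.58] -/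
theorem exists_hom_closure_pair {G : Type u} [Group G] [IsFreeGroup G] {x y : G}
    (hxy : x * y ≠ y * x) :
    ∃ Ψ : Subgroup.closure ({x, y} : Set G) →* Multiplicative ℤ × Multiplicative ℤ,
      Ψ ⟨x, Subgroup.subset_closure (by simp)⟩ = (Multiplicative.ofAdd 1, 1) ∧
      Ψ ⟨y, Subgroup.subset_closure (by simp)⟩ = (1, Multiplicative.ofAdd 1) := by
  classical
  set J := Subgroup.closure ({x, y} : Set G) with hJ
  have hxJ : x ∈ J := Subgroup.subset_closure (by simp)
  have hyJ : y ∈ J := Subgroup.subset_closure (by simp)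
  set x' : J := ⟨x, hxJ⟩ with hx'
  set y' : J := ⟨y, hyJ⟩ with hy'
  have hxy' : x' * y' ≠ y' * x' := fun h => hxy (by simpa [hx', hy'] using congrArg Subtype.val h)
  obtain ⟨b₀, b₁, hb⟩ := exists_ne_generators_of_ne hxy'
  set e : J ≃* FreeGroup (IsFreeGroup.Generators J) := IsFreeGroup.toFreeGroup J with he
  -- coordinate characters of the basis
  let χ : IsFreeGroup.Generators J → (FreeGroup (IsFreeGroup.Generators J) →* Multiplicative ℤ) :=
    fun b => FreeGroup.lift fun b' => if b' = b then Multiplicative.ofAdd (1 : ℤ) else 1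
  let Φ : IsFreeGroup.Generators J → (J →* Multiplicative ℤ) := fun b => (χ b).comp e.toMonoidHom
  have hΦ : ∀ b b' : IsFreeGroup.Generators J,
      Φ b (e.symm (FreeGroup.of b')) = if b' = b then Multiplicative.ofAdd (1 : ℤ) else 1 := by
    intro b b'
    simp [Φ, χ]
  set g₀ : J := e.symm (FreeGroup.of b₀) with hg₀
  set g₁ : J := e.symm (FreeGroup.of b₁) with hg₁
  -- `x', y'` generate `J`
  have hgen : Subgroup.closure ({x', y'} : Set J) = ⊤ := by
    have h := Subgroup.closure_closure_coe_preimage (G := G) (k := ({x, y} : Set G))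
    have hset : ((↑) : J → G) ⁻¹' ({x, y} : Set G) = ({x', y'} : Set J) := by
      ext ⟨g, hg⟩
      simp [hx', hy', Subtype.ext_iff]
    rw [hset] at h
    exact h
  set Ψ₀ : J →* Multiplicative ℤ × Multiplicative ℤ := (Φ b₀).prod (Φ b₁) with hΨ₀
  have hrange : ∀ w : J, ∃ m n : ℤ, Ψ₀ x' ^ m * Ψ₀ y' ^ n = Ψ₀ w := by
    intro w
    have hw : Ψ₀ w ∈ Subgroup.map Ψ₀ (Subgroup.closure {x', y'}) := by
      rw [hgen]
      exact Subgroup.mem_map_of_mem _ (Subgroup.mem_top w)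
    rw [MonoidHom.map_closure, Set.image_pair] at hw
    exact Subgroup.mem_closure_pair.mp hw
  -- integer coordinates of `x', y'`
  set p₀ : ℤ := Multiplicative.toAdd (Φ b₀ x') with hp₀
  set p₁ : ℤ := Multiplicative.toAdd (Φ b₁ x') with hp₁
  set q₀ : ℤ := Multiplicative.toAdd (Φ b₀ y') with hq₀
  set q₁ : ℤ := Multiplicative.toAdd (Φ b₁ y') with hq₁
  have hcoord : ∀ m n : ℤ,
      Multiplicative.toAdd ((Ψ₀ x' ^ m * Ψ₀ y' ^ n).1) = m * p₀ + n * q₀ ∧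
      Multiplicative.toAdd ((Ψ₀ x' ^ m * Ψ₀ y' ^ n).2) = m * p₁ + n * q₁ := by
    intro m n
    simp [hΨ₀, hp₀, hp₁, hq₀, hq₁, toAdd_zpow]
  obtain ⟨α₀, β₀, h₀⟩ := hrange g₀
  obtain ⟨α₁, β₁, h₁⟩ := hrange g₁
  have e1 : α₀ * p₀ + β₀ * q₀ = 1 := by
    rw [← (hcoord α₀ β₀).1, h₀]
    simp [hΨ₀, hg₀, hΦ]
  have e2 : α₀ * p₁ + β₀ * q₁ = 0 := by
    rw [← (hcoord α₀ β₀).2, h₀]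
    simp [hΨ₀, hg₀, hΦ, hb]
  have e3 : α₁ * p₀ + β₁ * q₀ = 0 := by
    rw [← (hcoord α₁ β₁).1, h₁]
    simp [hΨ₀, hg₁, hΦ, Ne.symm hb]
  have e4 : α₁ * p₁ + β₁ * q₁ = 1 := by
    rw [← (hcoord α₁ β₁).2, h₁]
    simp [hΨ₀, hg₁, hΦ]
  -- the left inverse is a right inverse (2 × 2 integer matrices): first `det · det = 1`
  have hDE : (α₀ * β₁ - α₁ * β₀) * (p₀ * q₁ - p₁ * q₀) = 1 := by
    linear_combination' e1 * e4 - e2 * e3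
  have ea : α₀ * p₀ + α₁ * p₁ = 1 := by
    linear_combination (-(α₀ * p₀ + α₁ * p₁ - 1)) * hDE
      + ((p₀ * q₁ - p₁ * q₀) * α₀ * β₁) * e1 + (-((p₀ * q₁ - p₁ * q₀) * α₀ * β₀)) * e3
      + ((p₀ * q₁ - p₁ * q₀) * α₁ * β₁) * e2 + (-((p₀ * q₁ - p₁ * q₀) * α₁ * β₀)) * e4
  have eb : β₀ * p₀ + β₁ * p₁ = 0 := by
    linear_combination (-(β₀ * p₀ + β₁ * p₁)) * hDE
      + ((p₀ * q₁ - p₁ * q₀) * β₀ * β₁) * e1 + (-((p₀ * q₁ - p₁ * q₀) * β₀ * β₀)) * e3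
      + ((p₀ * q₁ - p₁ * q₀) * β₁ * β₁) * e2 + (-((p₀ * q₁ - p₁ * q₀) * β₁ * β₀)) * e4
  have ec : α₀ * q₀ + α₁ * q₁ = 0 := by
    linear_combination (-(α₀ * q₀ + α₁ * q₁)) * hDE
      + ((p₀ * q₁ - p₁ * q₀) * α₀ * α₀) * e3 + (-((p₀ * q₁ - p₁ * q₀) * α₀ * α₁)) * e1
      + ((p₀ * q₁ - p₁ * q₀) * α₁ * α₀) * e4 + (-((p₀ * q₁ - p₁ * q₀) * α₁ * α₁)) * e2
  have ed : β₀ * q₀ + β₁ * q₁ = 1 := by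
    linear_combination (-(β₀ * q₀ + β₁ * q₁ - 1)) * hDE
      + ((p₀ * q₁ - p₁ * q₀) * β₀ * α₀) * e3 + (-((p₀ * q₁ - p₁ * q₀) * β₀ * α₁)) * e1
      + ((p₀ * q₁ - p₁ * q₀) * β₁ * α₀) * e4 + (-((p₀ * q₁ - p₁ * q₀) * β₁ * α₁)) * e2
  -- the normalised character
  let Ψ₁ : J →* Multiplicative ℤ :=
    (zpowGroupHom α₀).comp (Φ b₀) * (zpowGroupHom α₁).comp (Φ b₁)
  let Ψ₂ : J →* Multiplicative ℤ :=
    (zpowGroupHom β₀).comp (Φ b₀) * (zpowGroupHom β₁).comp (Φ b₁)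
  refine ⟨Ψ₁.prod Ψ₂, ?_, ?_⟩
  · have h1 : Multiplicative.toAdd (Ψ₁ x') = 1 := by
      simp only [Ψ₁, MonoidHom.mul_apply, MonoidHom.comp_apply, zpowGroupHom_apply, toAdd_mul,
        toAdd_zpow, smul_eq_mul]
      rw [← hp₀, ← hp₁]
      linarith [ea]
    have h2 : Multiplicative.toAdd (Ψ₂ x') = 0 := by
      simp only [Ψ₂, MonoidHom.mul_apply, MonoidHom.comp_apply, zpowGroupHom_apply, toAdd_mul,
        toAdd_zpow, smul_eq_mul]
      rw [← hp₀, ← hp₁]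
      linarith [eb]
    rw [MonoidHom.prod_apply, Prod.mk.injEq]
    exact ⟨Multiplicative.toAdd.injective (by simpa using h1), Multiplicative.toAdd.injective (by simpa using h2)⟩
  · have h1 : Multiplicative.toAdd (Ψ₁ y') = 0 := by
      simp only [Ψ₁, MonoidHom.mul_apply, MonoidHom.comp_apply, zpowGroupHom_apply, toAdd_mul,
        toAdd_zpow, smul_eq_mul]
      rw [← hq₀, ← hq₁]
      linarith [ec]
    have h2 : Multiplicative.toAdd (Ψ₂ y') = 1 := by
      simp only [Ψ₂, MonoidHom.mul_apply, MonoidHom.comp_apply, zpowGroupHom_apply, toAdd_mul,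
        toAdd_zpow, smul_eq_mul]
      rw [← hq₀, ← hq₁]
      linarith [ed]
    rw [MonoidHom.prod_apply, Prod.mk.injEq]
    exact ⟨Multiplicative.toAdd.injective (by simpa using h1), Multiplicative.toAdd.injective (by simpa using h2)⟩

/-- **The images of non-commuting `x, y` in `⟨x, y⟩ᵃᵇ` generate a free abelian group of rank two**
(they satisfy no non-trivial relation): p. 58, "`J` is a free group of rank 2".
[cite: Mochizuki2012, Lem 2.7(iii) p.58] -/
theorem abelianization_pair_independent {G : Type u} [Group G] [IsFreeGroup G] {x y : G}
    (hxy : x * y ≠ y * x) (i j : ℤ)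
    (h : Abelianization.of (⟨x, Subgroup.subset_closure (by simp)⟩ : Subgroup.closure ({x, y} : Set G)) ^ i *
      Abelianization.of (⟨y, Subgroup.subset_closure (by simp)⟩ : Subgroup.closure ({x, y} : Set G)) ^ j
        = 1) : i = 0 ∧ j = 0 := by
  obtain ⟨Ψ, hx, hy⟩ := exists_hom_closure_pair hxy
  have h' := congrArg (Abelianization.lift Ψ) h
  rw [map_mul, map_zpow, map_zpow, Abelianization.lift_apply_of, Abelianization.lift_apply_of, hx, hy,
    MonoidHom.map_one] at h'
  have h1 := congrArg (fun z : Multiplicative ℤ × Multiplicative ℤ => Multiplicative.toAdd z.1) h'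
  have h2 := congrArg (fun z : Multiplicative ℤ × Multiplicative ℤ => Multiplicative.toAdd z.2) h'
  simp at h1 h2
  exact ⟨h1, h2⟩

/-- **`xᵃ · yᵇ ≠ 1` for all `(a, b) ≠ (0, 0)`** when `x, y` are non-commuting elements of a free group
(p. 58, proof of (iii)). [cite: Mochizuki2012, Lem 2.7(iii) p.58] -/
theorem zpow_mul_zpow_ne_one {G : Type u} [Group G] [IsFreeGroup G] {x y : G}
    (hxy : x * y ≠ y * x) {a b : ℤ} (hab : (a, b) ≠ (0, 0)) : x ^ a * y ^ b ≠ 1 := by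
  intro h
  have hxJ : x ∈ Subgroup.closure ({x, y} : Set G) := Subgroup.subset_closure (by simp)
  have hyJ : y ∈ Subgroup.closure ({x, y} : Set G) := Subgroup.subset_closure (by simp)
  have h' : (⟨x, hxJ⟩ : Subgroup.closure ({x, y} : Set G)) ^ a * ⟨y, hyJ⟩ ^ b = 1 :=
    Subtype.ext (by simpa using h)
  have h'' := congrArg (Abelianization.of (G := Subgroup.closure ({x, y} : Set G))) h'
  rw [map_mul, map_zpow, map_zpow, map_one] at h''
  obtain ⟨ha, hb⟩ := abelianization_pair_independent hxy a b h''
  exact hab (by rw [ha, hb])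

/-- In a free group, **`x` and `y` commute as soon as some non-trivial powers do**: if
`xᵃ · yᵇ = 1` with `(a, b) ≠ (0, 0)` then `x y = y x` (contrapositive of `zpow_mul_zpow_ne_one`;
Lyndon–Schupp Ch. I Prop. 2.17). [cite: Mochizuki2012, Lem 2.7(iii) p.58] -/
theorem commute_of_zpow_mul_zpow_eq_one {G : Type u} [Group G] [IsFreeGroup G] {x y : G}
    {a b : ℤ} (hab : (a, b) ≠ (0, 0)) (h : x ^ a * y ^ b = 1) : x * y = y * x := by
  by_contra hxy
  exact zpow_mul_zpow_ne_one hxy hab h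

/-! ### Abelianizations of free groups are torsion-free (p. 58) -/

/-- **"The abelianization of any finite index subgroup of `G` is torsion-free"** (p. 58, proof of
(iii)), free case: for a free group `K` (e.g. any subgroup of a free group, by Nielsen–Schreier),
`Kᵃᵇ ≅ ℤ^{(B)}` has no torsion: `c ^ d = 1`, `d ≠ 0` ⇒ `c = 1`.
[cite: Mochizuki2012, Lem 2.7(iii) p.58] -/
theorem abelianization_eq_one_of_pow_eq_one {K : Type u} [Group K] [IsFreeGroup K]
    {c : Abelianization K} {d : ℕ} (hd : d ≠ 0) (h : c ^ d = 1) : c = 1 := by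
  let E := (IsFreeGroup.toFreeGroup K).abelianizationCongr
  let v : FreeAbelianGroup (IsFreeGroup.Generators K) := Additive.ofMul (E c)
  have hv : d • v = 0 := by
    have h1 : E c ^ d = 1 := by rw [← map_pow, h, map_one]
    have h2 := congrArg Additive.ofMul h1
    rwa [ofMul_pow, ofMul_one] at h2
  have hv0 : v = 0 := by
    have h2 := congrArg (FreeAbelianGroup.equivFinsupp _) hv
    rw [map_nsmul, map_zero] at h2
    have h3 : FreeAbelianGroup.equivFinsupp _ v = 0 := by
      ext b
      have h4 := DFunLike.congr_fun h2 b
      simp only [Finsupp.smul_apply, Finsupp.coe_zero, Pi.zero_apply, nsmul_eq_mul] at h4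
      rcases mul_eq_zero.mp h4 with h5 | h5
      · exact absurd h5 (by exact_mod_cast hd)
      · simpa using h5
    exact (FreeAbelianGroup.equivFinsupp _).injective (by rw [h3, map_zero])
  have hE : E c = 1 := congrArg Additive.toMul hv0
  exact E.injective (by rw [hE, map_one])

end FreeOrSurface

end Literature.IUT.HodgeTheaters
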